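import Summits.Ventures.HSemireg.WedgeHankelBoxSiegelIdealBasis

/-!
# Venture HSemireg — THE BOX SIEGEL IDEAL BY DOLBEAULT TYPE: the box Siegel ideal is bihomogeneous in (number of `x`-letters, number of `y`-letters),
# and on the block `H^b(⋀^a T_Y)` (`Y = X₀ × ⋯ × X_{n−1}`) its piece has codimension = the number of box-standard monomials of bidegree `(a, b)`

HONEST FRAMING. Part of the Lean index of the computation cell `pub-hsemireg` (seat p10 gen 12, Sunday typer «UNIFORM-IN-n»).
Finite-dimensional EXTERIOR ALGEBRA over a field ONLY: no variety, no cohomology theory, no sheaf, no Ext group, no semiregularity map; nothing here says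
that HC / HC_CM / HC_AV holds; no Literature fact is declared or used.  Custodian versions as in `WedgeHankelBoxSiegelIdeal` (1/3); the dictionary (a monomial with
`a` letters `x^{(i)}_c ↔ ∂` and `b` letters `y^{(i)}_c ↔ dz̄` ↦ the Dolbeault block `H^b(⋀^a T_Y)` of `HT^{a+b}(Y)`, cf. gen 11's `WedgeHankelSiegelIdealPlanes` for one factor)
is QUOTED, never asserted.

THIS FILE (namespace `Summit.Ventures.HSemireg.Wedge.HankelBoxSiegelIdeal` continued; imports `WedgeHankelBoxSiegelIdealBasis`):
* §18 bidegrees on the box model: `xcnt t` / `ycnt t` (letters of `t` in the `x`- / `y`-half of their factor), additive on disjoint unions; the BOX DOLBEAULT BLOCK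
  `plane₂ a b := span{E_t : xcnt t = a, ycnt t = b}` (th-7's support spans `Weil.Sp`); blocks multiply into blocks; every embedded standard monomial, every embedded
  Siegel 2-vector (`∈ plane₂ 1 1`), every box-standard monomial (`∈ plane₂ (xdeg f) (ydeg f)`) and every generator of the box Siegel ideal is BIHOMOGENEOUS.
* §19 the block projector `π_{ab}` (th-7's `Weil.proj`) PRESERVES the box Siegel ideal and the box-standard span (`proj_mem_boxSiegelIdeal`, `proj_stdmon`); hence
  **`plane₂_eq_sup`: `plane₂ a b = span{box-standard monomials of bidegree (a,b)} ⊕ (boxSiegelIdeal_{a+b} ⊓ plane₂ a b)`** and the DIMENSION IDENTITY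
  **`finrank_boxSiegelIdeal_inf_plane₂`: `dim(boxSiegelIdeal_{a+b} ∩ plane₂ a b) + #{f ∈ BIdx n (a+b) : bideg f = (a,b)} = #{t : xcnt t = a, ycnt t = b}`** (the right side is
  `C(M,a)·C(M,b)`, `M = Σ m_i`, by choosing the `x`- and `y`-letters separately — left as the monomial count here); **pure types carry no isotropic vectors**:
  `boxSiegelIdeal_inf_plane₂_pure_x / _pure_y` (`(k,0)` and `(0,k)`), since every generator has an `x`- and a `y`-letter.
NOT typed (honest): the closed count `#{f : bideg f = (a,b)} = [u^a v^b] Π_i Σ_j C(m_i,j)·h_j(u,v)` and `#{t} = C(M,a)C(M,b)` as binomials; per-block RANKS of `θ ↦ θ ∧ F` for boxes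
(the blocks' images overlap, as for one factor); anything Ext-side.  Class side only.
-/

open Module

namespace Summit.Ventures.HSemireg.Wedge.HankelBoxSiegelIdeal

open Summit.Ventures.HSemireg.Wedge Summit.Ventures.HSemireg.Wedge.Kunneth Summit.Ventures.HSemireg.Wedge.MixedBox
  Summit.Ventures.HSemireg.Wedge.HankelSiegel Summit.Ventures.HSemireg.Wedge.HankelSiegelIdeal
  Summit.Ventures.HSemireg.Wedge.HankelBox

variable (K : Type*) [Field K]

/-! ## §18. Bidegrees on the box model -/

section Generic

variable {I : Type*} [LinearOrder I] [Fintype I]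

omit [Fintype I] in
/-- a filtered count is additive on disjoint unions (union spelled through the linear order, as in `B_mul_B`). -/
lemma card_filter_union_of_disjoint (p : I → Prop) [DecidablePred p] {s t : Finset I} (h : Disjoint s t) :
    ((s ∪ t).filter p).card = (s.filter p).card + (t.filter p).card := by
  rw [Finset.filter_union, Finset.card_union_of_disjoint (Finset.disjoint_filter_filter h)]

omit [LinearOrder I] [Fintype I] in
/-- a filtered count transports along an embedding. -/
lemma card_filter_map {J : Type*} (φ : J ↪ I) (p : I → Prop) [DecidablePred p] (s : Finset J) :
    ((s.map φ).filter p).card = (s.filter (fun j => p (φ j))).card := by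
  rw [Finset.filter_map, Finset.card_map]
  rfl

end Generic

section Box

variable {n : ℕ} (m : Fin n → ℕ)

/-- number of `x`-letters of a monomial support (letters in the first half of their factor). -/
def xcnt (t : Finset (Gen m)) : ℕ := (t.filter fun g => ((ofLex g).2 : ℕ) < m (ofLex g).1).card

/-- number of `y`-letters of a monomial support (letters in the second half of their factor). -/
def ycnt (t : Finset (Gen m)) : ℕ := (t.filter fun g => m (ofLex g).1 ≤ ((ofLex g).2 : ℕ)).card

/-- every letter is an `x`- or a `y`-letter: `xcnt t + ycnt t = |t|`. -/
lemma xcnt_add_ycnt (t : Finset (Gen m)) : xcnt m t + ycnt m t = t.card := by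
  rw [xcnt, ycnt]
  have h : (t.filter fun g => m (ofLex g).1 ≤ ((ofLex g).2 : ℕ)) = t.filter fun g => ¬ ((ofLex g).2 : ℕ) < m (ofLex g).1 :=
    Finset.filter_congr fun g _ => Nat.not_lt.symm
  rw [h, Finset.card_filter_add_card_filter_not]

/-- **THE BOX DOLBEAULT BLOCK `plane₂ a b`**: the span of the monomials with `a` `x`-letters and `b` `y`-letters (dictionary: `H^b(⋀^a T_Y)` inside `HT^{a+b}(Y)`). -/
noncomputable def plane₂ (a b : ℕ) : Submodule K (HT K (Gen m)) := Weil.Sp K fun t : Finset (Gen m) => xcnt m t = a ∧ ycnt m t = b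

/-- `dim plane₂ a b` = the number of monomials of bidegree `(a, b)`. -/
lemma finrank_plane₂ (a b : ℕ) : finrank K (plane₂ K m a b) = (Finset.univ.filter fun t : Finset (Gen m) => xcnt m t = a ∧ ycnt m t = b).card :=
  Weil.finrank_Sp _

/-- a block lies in the homogeneous component of its total degree. -/
lemma plane₂_le_exteriorPower (a b : ℕ) : plane₂ K m a b ≤ ⋀[K]^(a + b) (Gen m → K) := by
  rw [exteriorPower_eq_Hom_univ_gen, plane₂, Weil.Hom_eq_Sp]
  exact Weil.Sp_mono fun t ht => ⟨Finset.subset_univ t, by rw [← xcnt_add_ycnt m t, ht.1, ht.2]⟩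

/-- **blocks multiply into blocks: `plane₂ a b ∧ plane₂ a' b' ≤ plane₂ (a+a') (b+b')`.** -/
theorem mul_mem_plane₂ {a b a' b' : ℕ} {v w : HT K (Gen m)} (hv : v ∈ plane₂ K m a b) (hw : w ∈ plane₂ K m a' b') :
    v * w ∈ plane₂ K m (a + a') (b + b') := by
  refine Weil.mul_mem_Sp (fun s t hst hs ht => ?_) hv hw
  refine ⟨?_, ?_⟩
  · rw [← hs.1, ← ht.1]; exact card_filter_union_of_disjoint _ hst
  · rw [← hs.2, ← ht.2]; exact card_filter_union_of_disjoint _ hst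

/-- a monomial lies in the block of its bidegree. -/
lemma B_mem_plane₂ (t : Finset (Gen m)) : B K (Gen m) t ∈ plane₂ K m (xcnt m t) (ycnt m t) := Weil.B_mem_Sp ⟨rfl, rfl⟩

/-- bidegree of a one-factor support `x_P ∪ y_Q`: `|P|` letters below `m_i`, `|Q|` letters from `m_i` on. -/
lemma card_filter_xs_ys {M : ℕ} (P Q : Finset (Fin M)) :
    ((xs P ∪ ys Q).filter fun g : Fin (M + M) => (g : ℕ) < M).card = P.card ∧
      ((xs P ∪ ys Q).filter fun g : Fin (M + M) => M ≤ (g : ℕ)).card = Q.card := by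
  have hPx : (xs P).filter (fun g : Fin (M + M) => (g : ℕ) < M) = xs P :=
    Finset.filter_true_of_mem fun g hg => by obtain ⟨c, -, rfl⟩ := Finset.mem_map.mp hg; exact c.2
  have hQx : (ys Q).filter (fun g : Fin (M + M) => (g : ℕ) < M) = ∅ :=
    Finset.filter_false_of_mem fun g hg => by obtain ⟨c, -, rfl⟩ := Finset.mem_map.mp hg; show ¬ (M + (c : ℕ) < M); omega
  have hPy : (xs P).filter (fun g : Fin (M + M) => M ≤ (g : ℕ)) = ∅ :=
    Finset.filter_false_of_mem fun g hg => by obtain ⟨c, -, rfl⟩ := Finset.mem_map.mp hg; show ¬ (M ≤ (c : ℕ)); have := c.2; omega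
  have hQy : (ys Q).filter (fun g : Fin (M + M) => M ≤ (g : ℕ)) = ys Q :=
    Finset.filter_true_of_mem fun g hg => by obtain ⟨c, -, rfl⟩ := Finset.mem_map.mp hg; show M ≤ M + (c : ℕ); omega
  rw [Finset.filter_union, Finset.filter_union, Finset.card_union_of_disjoint (Finset.disjoint_filter_filter (disjoint_xs_ys P Q)),
    Finset.card_union_of_disjoint (Finset.disjoint_filter_filter (disjoint_xs_ys P Q)), hPx, hQx, hPy, hQy, Finset.card_empty,
    card_xs, card_ys]
  exact ⟨rfl, by rw [zero_add]⟩

/-- bidegree of an embedded one-factor support `(x_P ∪ y_Q).map emb_i`: `(|P|, |Q|)`. -/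
lemma xcnt_ycnt_map (i : Fin n) (P Q : Finset (Fin (m i))) :
    xcnt m ((xs P ∪ ys Q).map (facEmb m i).toEmbedding) = P.card ∧ ycnt m ((xs P ∪ ys Q).map (facEmb m i).toEmbedding) = Q.card := by
  rw [xcnt, ycnt, card_filter_map, card_filter_map]
  exact card_filter_xs_ys P Q

/-- **the embedded standard monomial `emb_i(x_{S∖A} y_A)` lies in `plane₂ (|S| − b) b`** (`b ≤ |S|`). -/
theorem emb_smon_mem_plane₂ (i : Fin n) (S : Finset (Fin (m i))) {b : ℕ} (hb : b ≤ S.card) :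
    emb K (facEmb m i) (smon K S b) ∈ plane₂ K m (S.card - b) b := by
  rw [smon, B_mul_B, map_smul, emb_B]
  refine Submodule.smul_mem _ _ ?_
  have h := xcnt_ycnt_map m i (S \ canon S b) (canon S b)
  rw [Finset.card_sdiff_of_subset (canon_subset S b), card_canon hb] at h
  exact Weil.B_mem_Sp h

/-- **the embedded Siegel 2-vectors lie in `plane₂ 1 1`** (one `x`- and one `y`-letter). -/
theorem bsgen_mem_plane₂ (x : Σ i : Fin n, SIdx (m i)) : bsgen K m x ∈ plane₂ K m 1 1 := by
  obtain ⟨i, ⟨c, a⟩⟩ := x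
  have hXY : ∀ (p q : ℕ) (hp : p < m i) (hq : q < m i),
      emb K (facEmb m i) (Hankel.X K (m i) p * Hankel.Y K (m i) q) ∈ plane₂ K m 1 1 := by
    intro p q hp hq
    rw [X_eq_gx K ⟨p, hp⟩, Y_eq_gx K ⟨q, hq⟩, gx_mul_gy, map_smul, emb_B]
    refine Submodule.smul_mem _ _ ?_
    have h := xcnt_ycnt_map m i {⟨p, hp⟩} {⟨q, hq⟩}
    rw [Finset.card_singleton, Finset.card_singleton] at h
    have hset : ({Fin.castAdd (m i) ⟨p, hp⟩, Fin.natAdd (m i) ⟨q, hq⟩} : Finset (Hankel.In (m i))) = xs {⟨p, hp⟩} ∪ ys {⟨q, hq⟩} := by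
      rw [xs, ys, Finset.map_singleton, Finset.map_singleton]; rfl
    rw [hset]
    exact Weil.B_mem_Sp h
  have ha : (a : ℕ) < m i := by have := a.2; have := c.2; omega
  rw [bsgen, sgen, sv]
  split_ifs with h
  · rw [add_zero]; exact hXY _ _ ha c.2
  · rw [map_add]; exact Submodule.add_mem _ (hXY _ _ ha c.2) (hXY _ _ c.2 ha)

/-- the `x`-degree of a box-standard index: `Σ_i (|S_i| − b_i)`. -/
def xdeg (f : BI m) : ℕ := ∑ i : Fin n, ((f i).1.card - ((f i).2 : ℕ))

/-- the `y`-degree of a box-standard index: `Σ_i b_i`. -/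
def ydeg (f : BI m) : ℕ := ∑ i : Fin n, ((f i).2 : ℕ)

/-- prefix bidegrees. -/
def pxdeg (j : ℕ) (f : BI m) : ℕ := ∑ i : Fin n, if (i : ℕ) < j then (f i).1.card - ((f i).2 : ℕ) else 0

/-- prefix bidegrees. -/
def pydeg (j : ℕ) (f : BI m) : ℕ := ∑ i : Fin n, if (i : ℕ) < j then ((f i).2 : ℕ) else 0

/-- one more slot (generic bookkeeping for prefix sums over `Fin n`). -/
lemma psum_succ (c : Fin n → ℕ) {j : ℕ} (hj : j < n) :
    (∑ i : Fin n, if (i : ℕ) < j + 1 then c i else 0) = (∑ i : Fin n, if (i : ℕ) < j then c i else 0) + c ⟨j, hj⟩ := by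
  have key : ∀ i : Fin n, (if (i : ℕ) < j + 1 then c i else 0) = (if (i : ℕ) < j then c i else 0) + (if i = ⟨j, hj⟩ then c i else 0) := by
    intro i
    by_cases h1 : (i : ℕ) < j
    · rw [if_pos (by omega), if_pos h1, if_neg (fun h => by have := congrArg Fin.val h; simp at this; omega), add_zero]
    · by_cases h2 : i = ⟨j, hj⟩
      · rw [if_pos (by rw [h2]; simp), if_neg h1, if_pos h2, zero_add]
      · rw [if_neg (fun h => h2 (Fin.ext (by simp; omega))), if_neg h1, if_neg h2, add_zero]
  rw [Finset.sum_congr rfl fun i _ => key i, Finset.sum_add_distrib,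
    Finset.sum_eq_single_of_mem (⟨j, hj⟩ : Fin n) (Finset.mem_univ _) (fun i _ hi => if_neg hi), if_pos rfl]

/-- the full prefix is the whole sum. -/
lemma psum_top (c : Fin n → ℕ) : (∑ i : Fin n, if (i : ℕ) < n then c i else 0) = ∑ i : Fin n, c i :=
  Finset.sum_congr rfl fun i _ => if_pos i.2

/-- **every box-standard monomial of the first `j ≤ n` factors is bihomogeneous: `stdmon j f ∈ plane₂ (pxdeg j f) (pydeg j f)`** (`b_i ≤ |S_i|`). -/
theorem stdmon_mem_plane₂ : ∀ {j : ℕ}, j ≤ n → ∀ (f : BI m), (∀ i : Fin n, ((f i).2 : ℕ) ≤ (f i).1.card) →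
    stdmon K m j f ∈ plane₂ K m (pxdeg m j f) (pydeg m j f) := by
  intro j
  induction j with
  | zero =>
    intro _ f _
    have hx : pxdeg m 0 f = 0 := Finset.sum_eq_zero fun i _ => by simp
    have hy : pydeg m 0 f = 0 := Finset.sum_eq_zero fun i _ => by simp
    rw [hx, hy, stdmon_zero]
    have h1 : B K (Gen m) (∅ : Finset (Gen m)) = 1 := by
      rw [B, ExteriorAlgebra.basis_apply_ofCard (b K (Gen m)) Finset.card_empty]; simp [ExteriorAlgebra.ιMulti_family]
    rw [← h1]
    exact Weil.B_mem_Sp ⟨by simp [xcnt], by simp [ycnt]⟩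
  | succ j ih =>
    intro hj f hf
    have hj' : j < n := by omega
    rw [stdmon_succ K m hj', pxdeg, pydeg, psum_succ (fun i => (f i).1.card - ((f i).2 : ℕ)) hj', psum_succ (fun i => ((f i).2 : ℕ)) hj']
    exact mul_mem_plane₂ K m (ih (by omega) f hf) (emb_smon_mem_plane₂ K m ⟨j, hj'⟩ _ (hf _))

/-- in particular **`stdmon n f ∈ plane₂ (xdeg f) (ydeg f)`**. -/
theorem stdmon_mem_plane₂_top (f : BI m) (hf : ∀ i : Fin n, ((f i).2 : ℕ) ≤ (f i).1.card) :
    stdmon K m n f ∈ plane₂ K m (xdeg m f) (ydeg m f) := by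
  have h := stdmon_mem_plane₂ K m le_rfl f hf
  rwa [pxdeg, pydeg, psum_top, psum_top] at h

/-- **every generator `E_t ∧ emb_i(s_{ab})` of the box Siegel ideal is bihomogeneous, of bidegree `(xcnt t + 1, ycnt t + 1)`.** -/
theorem B_mul_bsgen_mem_plane₂ (t : Finset (Gen m)) (x : Σ i : Fin n, SIdx (m i)) :
    B K (Gen m) t * bsgen K m x ∈ plane₂ K m (xcnt m t + 1) (ycnt m t + 1) :=
  mul_mem_plane₂ K m (B_mem_plane₂ K m t) (bsgen_mem_plane₂ K m x)

/-! ## §19. The block projector preserves the box Siegel ideal and the box-standard span; the decomposition block by block -/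

/-- **the block projector `π_{ab}` maps the box Siegel ideal into itself** (each generator is bihomogeneous: it is kept or killed). -/
theorem proj_mem_boxSiegelIdeal (a b k : ℕ) {θ : HT K (Gen m)} (hθ : θ ∈ boxSiegelIdeal K m k) :
    Weil.proj (K := K) (fun t : Finset (Gen m) => xcnt m t = a ∧ ycnt m t = b) θ ∈ boxSiegelIdeal K m k := by
  classical
  rw [boxSiegelIdeal_eq_span] at hθ ⊢
  induction hθ using Submodule.span_induction with
  | mem g hg =>
    obtain ⟨⟨t, x⟩, hk, rfl⟩ := hg
    have hmem := B_mul_bsgen_mem_plane₂ K m t x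
    by_cases h : xcnt m t + 1 = a ∧ ycnt m t + 1 = b
    · rw [Weil.proj_eq_self (Q := fun s => xcnt m s = xcnt m t + 1 ∧ ycnt m s = ycnt m t + 1) (fun s hs => ⟨hs.1.trans h.1, hs.2.trans h.2⟩) hmem]
      exact Submodule.subset_span ⟨(t, x), hk, rfl⟩
    · rw [Weil.proj_eq_zero (Q := fun s => xcnt m s = xcnt m t + 1 ∧ ycnt m s = ycnt m t + 1)
        (fun s hs hs' => h ⟨hs.1.symm.trans hs'.1, hs.2.symm.trans hs'.2⟩) hmem]
      exact Submodule.zero_mem _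
  | zero => rw [map_zero]; exact Submodule.zero_mem _
  | add x y _ _ hx hy => rw [map_add]; exact Submodule.add_mem _ hx hy
  | smul c x _ hx => rw [map_smul]; exact Submodule.smul_mem _ _ hx

/-- the box-standard monomials of bidegree `(a, b)` in total degree `k`. -/
noncomputable def stdmonAt (k a b : ℕ) : {f : BIdx m n k // xdeg m f.1 = a ∧ ydeg m f.1 = b} → HT K (Gen m) := fun f => stdmon K m n f.1.1

/-- the box-standard monomials of a fixed bidegree are linearly independent (a sub-family of an independent family). -/
lemma linearIndependent_stdmonAt (k a b : ℕ) : LinearIndependent K (stdmonAt K m k a b) :=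
  (linearIndependent_stdmon K m le_rfl k).comp _ Subtype.val_injective

/-- their span lies in the box-standard span and in the block. -/
lemma span_stdmonAt_le (k a b : ℕ) :
    Submodule.span K (Set.range (stdmonAt K m k a b)) ≤ boxStd K m n k ⊓ plane₂ K m a b := by
  rw [Submodule.span_le]
  rintro _ ⟨f, rfl⟩
  refine ⟨?_, ?_⟩
  · rw [← span_stdmon K m le_rfl]; exact Submodule.subset_span ⟨f.1, rfl⟩
  · have h := stdmon_mem_plane₂_top K m f.1.1 f.1.2.2.1
    rw [f.2.1, f.2.2] at h
    exact h

/-- **the block projector `π_{ab}` maps the box-standard span of degree `k` into the span of the box-standard monomials of bidegree `(a, b)`.** -/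
theorem proj_stdmon_mem (k a b : ℕ) {σ : HT K (Gen m)} (hσ : σ ∈ Submodule.span K (Set.range fun f : BIdx m n k => stdmon K m n f.1)) :
    Weil.proj (K := K) (fun t : Finset (Gen m) => xcnt m t = a ∧ ycnt m t = b) σ ∈ Submodule.span K (Set.range (stdmonAt K m k a b)) := by
  classical
  induction hσ using Submodule.span_induction with
  | mem g hg =>
    obtain ⟨f, rfl⟩ := hg
    have hmem := stdmon_mem_plane₂_top K m f.1 f.2.2.1
    by_cases h : xdeg m f.1 = a ∧ ydeg m f.1 = b
    · rw [Weil.proj_eq_self (Q := fun s => xcnt m s = xdeg m f.1 ∧ ycnt m s = ydeg m f.1) (fun s hs => ⟨hs.1.trans h.1, hs.2.trans h.2⟩) hmem]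
      exact Submodule.subset_span ⟨⟨f, h⟩, rfl⟩
    · rw [Weil.proj_eq_zero (Q := fun s => xcnt m s = xdeg m f.1 ∧ ycnt m s = ydeg m f.1)
        (fun s hs hs' => h ⟨hs.1.symm.trans hs'.1, hs.2.symm.trans hs'.2⟩) hmem]
      exact Submodule.zero_mem _
  | zero => rw [map_zero]; exact Submodule.zero_mem _
  | add x y _ _ hx hy => rw [map_add]; exact Submodule.add_mem _ hx hy
  | smul c x _ hx => rw [map_smul]; exact Submodule.smul_mem _ _ hx

/-- **THE BLOCK DECOMPOSITION: `plane₂ a b = span{box-standard monomials of bidegree (a,b)} ⊔ (boxSiegelIdeal_{a+b} ⊓ plane₂ a b)`.** -/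
theorem plane₂_eq_sup (a b : ℕ) :
    plane₂ K m a b = Submodule.span K (Set.range (stdmonAt K m (a + b) a b)) ⊔ (boxSiegelIdeal K m (a + b) ⊓ plane₂ K m a b) := by
  classical
  refine le_antisymm (fun θ hθ => ?_) (sup_le ((span_stdmonAt_le K m _ a b).trans inf_le_right) inf_le_right)
  have hk : θ ∈ (⋀[K]^(a + b) (Gen m → K) : Submodule K (HT K (Gen m))) := plane₂_le_exteriorPower K m a b hθ
  rw [exteriorPower_eq_span_stdmon_sup, Submodule.mem_sup] at hk
  obtain ⟨σ, hσ, ι, hι, rfl⟩ := hk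
  have hπ : Weil.proj (K := K) (fun t : Finset (Gen m) => xcnt m t = a ∧ ycnt m t = b) (σ + ι) = σ + ι :=
    Weil.proj_eq_self (fun s hs => hs) hθ
  rw [← hπ, map_add]
  exact Submodule.add_mem_sup (proj_stdmon_mem K m _ a b hσ) ⟨proj_mem_boxSiegelIdeal K m a b _ hι, Weil.proj_mem _ _⟩

/-- the two pieces of the block decomposition meet trivially. -/
theorem span_stdmonAt_inf (a b : ℕ) :
    Submodule.span K (Set.range (stdmonAt K m (a + b) a b)) ⊓ (boxSiegelIdeal K m (a + b) ⊓ plane₂ K m a b) = ⊥ := by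
  rw [eq_bot_iff]
  calc Submodule.span K (Set.range (stdmonAt K m (a + b) a b)) ⊓ (boxSiegelIdeal K m (a + b) ⊓ plane₂ K m a b)
      ≤ boxStd K m n (a + b) ⊓ boxSiegelIdeal K m (a + b) :=
        inf_le_inf ((span_stdmonAt_le K m _ a b).trans inf_le_left) inf_le_left
    _ = ⊥ := boxStd_inf_boxSiegelIdeal K m (a + b)

/-- **THE DIMENSION IDENTITY BY DOLBEAULT TYPE: `dim(boxSiegelIdeal_{a+b} ∩ plane₂ a b) + #{box-standard monomials of bidegree (a,b)} = #{monomials of bidegree (a,b)}`**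
(the right side is `C(M,a)·C(M,b)`, `M = Σ_i m_i`; every field, every number of factors and dimensions). -/
theorem finrank_boxSiegelIdeal_inf_plane₂ (a b : ℕ) :
    finrank K ↥(boxSiegelIdeal K m (a + b) ⊓ plane₂ K m a b) + Fintype.card {f : BIdx m n (a + b) // xdeg m f.1 = a ∧ ydeg m f.1 = b} =
      (Finset.univ.filter fun t : Finset (Gen m) => xcnt m t = a ∧ ycnt m t = b).card := by
  have h1 := Submodule.finrank_sup_add_finrank_inf_eq (Submodule.span K (Set.range (stdmonAt K m (a + b) a b)))
    (boxSiegelIdeal K m (a + b) ⊓ plane₂ K m a b)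
  rw [← plane₂_eq_sup, span_stdmonAt_inf, finrank_bot, add_zero, finrank_span_eq_card (linearIndependent_stdmonAt K m _ a b),
    finrank_plane₂] at h1
  omega

/-- **PURE `x`-TYPE CARRIES NO ISOTROPIC VECTORS: `boxSiegelIdeal_k ∩ plane₂ k 0 = 0`** (every generator has a `y`-letter). -/
theorem boxSiegelIdeal_inf_plane₂_pure_x (k : ℕ) : boxSiegelIdeal K m k ⊓ plane₂ K m k 0 = ⊥ := by
  have hle : boxSiegelIdeal K m k ≤ Weil.Sp K (fun t : Finset (Gen m) => 1 ≤ ycnt m t) := by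
    rw [boxSiegelIdeal_eq_span, Submodule.span_le]
    rintro _ ⟨⟨t, x⟩, -, rfl⟩
    exact Weil.Sp_mono (fun s hs => by rw [hs.2]; omega) (B_mul_bsgen_mem_plane₂ K m t x)
  rw [eq_bot_iff]
  calc boxSiegelIdeal K m k ⊓ plane₂ K m k 0 ≤ Weil.Sp K (fun t : Finset (Gen m) => 1 ≤ ycnt m t) ⊓ plane₂ K m k 0 := inf_le_inf hle le_rfl
    _ = ⊥ := Weil.Sp_inf_Sp_eq_bot fun s hs hs' => by have := hs'.2; omega

/-- **PURE `y`-TYPE CARRIES NO ISOTROPIC VECTORS: `boxSiegelIdeal_k ∩ plane₂ 0 k = 0`** (every generator has an `x`-letter). -/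
theorem boxSiegelIdeal_inf_plane₂_pure_y (k : ℕ) : boxSiegelIdeal K m k ⊓ plane₂ K m 0 k = ⊥ := by
  have hle : boxSiegelIdeal K m k ≤ Weil.Sp K (fun t : Finset (Gen m) => 1 ≤ xcnt m t) := by
    rw [boxSiegelIdeal_eq_span, Submodule.span_le]
    rintro _ ⟨⟨t, x⟩, -, rfl⟩
    exact Weil.Sp_mono (fun s hs => by rw [hs.1]; omega) (B_mul_bsgen_mem_plane₂ K m t x)
  rw [eq_bot_iff]
  calc boxSiegelIdeal K m k ⊓ plane₂ K m 0 k ≤ Weil.Sp K (fun t : Finset (Gen m) => 1 ≤ xcnt m t) ⊓ plane₂ K m 0 k := inf_le_inf hle le_rfl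
    _ = ⊥ := Weil.Sp_inf_Sp_eq_bot fun s hs hs' => by have := hs'.1; omega

end Box

end Summit.Ventures.HSemireg.Wedge.HankelBoxSiegelIdeal
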